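import Literature.IUT.HodgeTheaters.CoveringsErrata
import Literature.AnabelianGeometry.AbsoluteAnabelian.SecondCountableExtension
import Mathlib.Topology.ClopenBox
import HarnessLib

/-!
# [IUTchI] Remark 2.5.3 (ii) (E2) (`Rmk253.TameGaloisCountable`): the typed row at an extension `E` is
# EXACTLY "Galois-countability of `Δ`" — characterization and the general instance form (PROOF-ONLY)

S. Mochizuki, *Inter-universal Teichmüller theory I*, kurims manuscript (May 2020), Remark 2.5.3 (ii) (E2),
p. 53: "if `k` is a field whose absolute Galois group is Galois-countable, and `U` is [the interior of a
connected proper log smooth log scheme over `k`], then the tamely ramified arithmetic fundamental group of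
`U` … is itself Galois-countable [cf., e.g., [AbsTopI], Proposition 2.2]" ([IUTchI] Rmk 2.5.3 (ii) (E2)
p.53) [claim: Mochizuki2012, status: disputed].  Typed by abc-iut-L5-t6 MODEL-RELATIVELY as the predicate
`Rmk253.TameGaloisCountable E : SecondCountableTopology E.gal → SecondCountableTopology E.arith` on
abc-iut-L4-t1's abstract profinite extensions `1 → Δ → Π → G → 1` (`CoveringsErrata.lean`); abc-iut
FACT-LIST row **F-1979** (plan/F-TRANCHES.tsv tranche 187; universal closure already REFUTED:
`not_forall_tameGaloisCountable`, `not_tameGaloisCountable_pow`; instance forms `tameGaloisCountable_of_geomTFG`,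
`tameGaloisCountable_of_arith_tfg`).

PROOF-ONLY companion (no `def`, no `structure`, no `instance`; abc-iut-f-187, F-TRANCHES programme D-0078).
What the kernel says about the ROW AT AN INSTANCE `E`:

* `tameGaloisCountable_of_secondCountable_geom` — the GENERAL INSTANCE FORM: (E2) holds for every
  extension whose geometric group `Δ = E.geom` is Galois-countable (second countable) — the three-space
  property of second countability for profinite groups, by abc-iut-L4's
  `FundamentalExtension.secondCountableTopology_arith` (`SecondCountableExtension.lean`: `Π` is second
  countable as soon as `G` is and `Δ` has countably many open subgroups) fed with Mathlib's
  `TopologicalSpace.Clopens.countable_iff_secondCountable` (`countable_setOf_isOpen_subgroup_of_secondCountable`: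
  a second countable profinite group has countably many open subgroups).  It subsumes
  `tameGaloisCountable_of_geomTFG` (a topologically finitely generated `Δ` is second countable) — print's
  bracketed route "[AbsTopI], Proposition 2.2";
* `tameGaloisCountable_iff_secondCountable_geom` — the row at `E` is EQUIVALENT to
  "`G` Galois-countable ⇒ `Δ` Galois-countable" (the converse direction: `Δ ⊆ Π` carries the subspace
  topology); so a consumer binding F-1979 at a named extension (e.g.
  `GoodLocalFrobenioidOfGaloisDdash.secondCountableTopology_PiC_of_tameGaloisCountable` at the initial
  Θ-datum's `D.geom.extF`, whose `G ≅ G_F` IS Galois-countable by (E1)) binds exactly the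
  Galois-countability of that extension's `Δ`; and the two refuting witnesses in the tree are exactly
  extensions with a non-second-countable `Δ` (`not_tameGaloisCountable_iff`).

Elementary topology over landed vocabulary; no new Prop fact; nothing here takes a side on [IUTchIII]
Cor. 3.12; a FACT row is an assumption label.
-/

namespace Literature.IUT.HodgeTheaters.Rmk253

open Literature.AnabelianGeometry.AbsoluteAnabelian TopologicalSpace

universe u

/-! ### A second countable profinite group has countably many open subgroups -/

/-- In a second countable profinite group (compact, Hausdorff, totally disconnected) the open subgroups
form a countable set (an open subgroup is clopen; the clopen sets of such a space are countable, Mathlib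
`TopologicalSpace.Clopens.countable_iff_secondCountable`).
[cite: Mochizuki2012, IUTchI Rmk 2.5.3 (ii) (E2) p.53] -/
theorem countable_setOf_isOpen_subgroup_of_secondCountable (Δ : Type u) [Group Δ] [TopologicalSpace Δ]
    [IsTopologicalGroup Δ] [CompactSpace Δ] [T2Space Δ] [TotallyDisconnectedSpace Δ]
    [SecondCountableTopology Δ] : {U : Subgroup Δ | IsOpen (U : Set Δ)}.Countable := by
  haveI : Countable (Clopens Δ) := Clopens.countable_iff_secondCountable.mpr inferInstance
  let f : {U : Subgroup Δ | IsOpen (U : Set Δ)} → Clopens Δ :=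
    fun U => ⟨(U.1 : Set Δ), ⟨U.1.isClosed_of_isOpen U.2, U.2⟩⟩
  have hf : Function.Injective f := by
    intro U V h
    have h' : ((U.1 : Subgroup Δ) : Set Δ) = (V.1 : Set Δ) := congrArg (fun c : Clopens Δ => (c : Set Δ)) h
    exact Subtype.ext (SetLike.coe_injective h')
  exact Set.countable_coe_iff.mp hf.countable

/-! ### The general instance form: (E2) holds whenever `Δ` is Galois-countable -/

/-- **[IUTchI] Remark 2.5.3 (ii) (E2) — GENERAL INSTANCE FORM of F-1979**: for every extension
`1 → Δ → Π → G → 1` of profinite groups whose geometric group `Δ` is Galois-countable (second countable),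
`TameGaloisCountable E` holds: `G` Galois-countable ⇒ `Π` Galois-countable.  (Subsumes
`tameGaloisCountable_of_geomTFG`: a topologically finitely generated profinite `Δ` is second countable.)
[cite: Mochizuki2012, IUTchI Rmk 2.5.3 (ii) (E2) p.53] -/
theorem tameGaloisCountable_of_secondCountable_geom (E : FundamentalExtension.{u})
    [SecondCountableTopology E.geom] : TameGaloisCountable E := by
  intro hgal
  haveI : SecondCountableTopology E.gal := hgal
  haveI : CompactSpace E.geom := isCompact_iff_compactSpace.mp E.isClosed_geom.isCompact
  exact E.secondCountableTopology_arith (countable_setOf_isOpen_subgroup_of_secondCountable E.geom)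

/-! ### The characterization: (E2) at `E` ⟺ (`G` Galois-countable ⇒ `Δ` Galois-countable) -/

/-- **F-1979 at an extension `E` is EXACTLY the Galois-countability of `Δ` (given that of `G`)**:
`TameGaloisCountable E ↔ (SecondCountableTopology E.gal → SecondCountableTopology E.geom)` — forward
because `Δ ⊆ Π` carries the subspace topology, backward by the three-space property
(`tameGaloisCountable_of_secondCountable_geom`). [cite: Mochizuki2012, IUTchI Rmk 2.5.3 (ii) (E2) p.53] -/
theorem tameGaloisCountable_iff_secondCountable_geom (E : FundamentalExtension.{u}) :
    TameGaloisCountable E ↔ (SecondCountableTopology E.gal → SecondCountableTopology E.geom) := by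
  refine ⟨fun h hgal => ?_, fun h hgal => ?_⟩
  · haveI : SecondCountableTopology E.arith := h hgal
    exact inferInstanceAs (SecondCountableTopology (E.geom : Set E.arith))
  · haveI : SecondCountableTopology E.geom := h hgal
    exact tameGaloisCountable_of_secondCountable_geom E hgal

/-- **The failure set of F-1979, exactly**: `TameGaloisCountable E` fails iff `G` is Galois-countable and
`Δ` is not — the shape of both refuting witnesses in the tree (`not_forall_tameGaloisCountable`: `Δ` an
uncountable product of `{±1}`; `not_tameGaloisCountable_pow`: `Δ = (ℤ/2)^ℝ`, `G = 1`).
[cite: Mochizuki2012, IUTchI Rmk 2.5.3 (ii) (E2) p.53] -/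
theorem not_tameGaloisCountable_iff (E : FundamentalExtension.{u}) :
    ¬ TameGaloisCountable E ↔ SecondCountableTopology E.gal ∧ ¬ SecondCountableTopology E.geom := by
  rw [tameGaloisCountable_iff_secondCountable_geom, Classical.not_imp]

end Literature.IUT.HodgeTheaters.Rmk253
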